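import Summits.ResolutionOfSingularities.ResolutionOfSingularities.Theorems.DivergentTowerClasses
import HarnessLib

/-!
# MonomialTowerClasses — monomial corner towers and germ hugging on forced point towers
(decomp-res node N48 «MonomialTowers», lens-4 g9; route-independent part, phase 1)

Source HOME/decomp-res-lens-4/g9/MonomialTowers.lean (sha256 8f38f901f7de0d3e, 515 lines; critic `lean check`
rc 0, 0 sorry), CRITIC-LEDGER row 58 (2026-08-30T08:32Z): CLEARED (MAP +1, DECIDED +1, residual 0).  Generation 8
(`DivergentTowerClasses`) left as the located residual of the tower side the VALUATIVE towers (hugging no germ).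
This node decides that class for every ground field by an extremal normal form:

* (M1) `CornerNormalForm` — NEW LEMMA with a complete paper proof (typed as a PORT = hypothesis of kernels; the
  `∀ n ≥ 1` shape is booked on the route as prover target #18): an infinite forced tower of the class hugging NO
  germ is, from some stage on, a MONOMIAL CORNER TOWER — every point a full corner of the tower's own exceptional
  divisor, the controlled transform a MONOMIAL ideal in the `d ≤ 4` corner parameters, the next point the origin
  of a standard chart (residue fields eventually constant), exponents moving by `α ↦ α[j ≔ |α| − n]`.  Proof
  sketch: (a) `ord_{pt i} I_i = n` persists (BGMW 3.2.2); (b) point blow-ups have SNC exceptional divisors; (c) in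
  the UFD `𝒪_{St m, pt m}` every prime factor of a germ is eventually EXITED (no germ is hugged), so its total
  transform becomes a monomial in the exceptional equations; (d) hence the controlled transforms are monomial;
  (e) a monomial ideal of order `n` contains the corner stratum in its top locus, so ISOLATION forces a full
  corner; (f) the next point, again a full corner, is a chart origin.  The STRENGTHENING (M1⁺) (critic row 58):
  hugging no germ also EXITS every exceptional component `V(x_l)`, i.e. every chart direction is played again and
  again — the corner tower is EXHAUSTIVE.
* (M2) the combinatorial object is typed completely over `Finset (Fin d → ℕ)` (`CornerTower d n`); an EXHAUSTIVE
  corner tower is impossible in five lines (`CornerTower.not_exhaustive`, PROVED: an order-`n` generator persists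
  and vanishes in every direction played), so the transversal class is DECIDED modulo (M1⁺) ALONE, for all `d` and
  all `k` (`transversalTowersTerminate_of_cornerNormalFormPlus`).  The plain leaf `NoCornerTower d n` (no infinite
  corner tower at all) is KNOWN modulo the realisation costume `CornerModel` + the counting port `TowerObstructs`
  (toric order reduction is characteristic-free) and ATTACKABLE directly (`d ≤ 1` PROVED; cheap theorem #17′).

The cut (EXACT by excluded middle): `ForcedTowersTerminate n ⟺ TransversalTowersTerminate n ∧
HuggingTowersTerminate n`, and `Hugging ⟺ ContactHugging ∧ WildHugging` (a REGULAR hypersurface germ is hugged —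
«permanent contact», ATTACKABLE by the dim-3 shadow — or only singular / higher-codimension germs are: the located
p-core of the tower side, IDEA-NEEDED).  Links to generation 8: the transversal class CONTAINS g8's valuative leaf
and the hugging class is implied by g8's germ-hugging leaf together with g8's two decided leaves.
ERRATUM recorded by the critic (row 58 on row 52): g8's «ValuativeTT IDEA-NEEDED / defect habitat» is WITHDRAWN —
decided elementary by (M1⁺).

Pure logic over the class files except §1 (finite combinatorics, PROVED).  The `∀ n ≥ 1` shapes are asides of
`Theses/MaxContactCut.lean` refining `NoForcedTowers` (30253); by-name kernels live in
`Theorems/MaxContactCutMonomialTowers.lean`.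
(Sources: BierstoneGrigorievMilmanWlodarczyk2011 §3, Lemma 3.2.2; Kollar2007 3.35–3.37, 3.75; CossartJannsenSaito2020;
Hartshorne1977 II.7; Shannon1973; HeinzerOlberdingToeniskoetter2017; Cutkosky2009.)
-/

open CategoryTheory AlgebraicGeometry
open Literature.AlgebraicGeometry.Resolution
open Summit.ResolutionOfSingularities.ResolutionOfSingularities.Theorems.WeakOrderReduction
open Summit.ResolutionOfSingularities.ResolutionOfSingularities.Theorems.ForcedTowerClasses
open Summit.ResolutionOfSingularities.ResolutionOfSingularities.Theorems.DivergentTowerClasses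

namespace Summit.ResolutionOfSingularities.ResolutionOfSingularities.Theorems.MonomialTowerClasses

/-! ## §1 The combinatorial object: monomial corner towers (pure `ℕ^d`) -/

/-- Exponent vectors of monomials in `d` corner parameters. -/
abbrev Expo (d : ℕ) := Fin d → ℕ

namespace Expo

/-- Total degree `|α|`. -/
def deg {d : ℕ} (α : Expo d) : ℕ := ∑ l, α l

/-- The CONTROLLED CHART TRANSFORM at marking `n` in direction `j`: `α ↦ α[j ≔ |α| − n]`. -/
def chart {d : ℕ} (n : ℕ) (j : Fin d) (α : Expo d) : Expo d :=
  Function.update α j (α.deg - n)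

/-- pure arithmetic. [folklore] -/
theorem le_deg {d : ℕ} (α : Expo d) (l : Fin d) : α l ≤ α.deg :=
  Finset.single_le_sum (f := α) (fun _ _ => Nat.zero_le _) (Finset.mem_univ l)

/-- pure arithmetic. [folklore] -/
theorem deg_update {d : ℕ} (α : Expo d) (j : Fin d) (v : ℕ) :
    deg (Function.update α j v) = v + (α.deg - α j) := by
  unfold deg
  rw [Finset.sum_update_of_mem (Finset.mem_univ j), Finset.sdiff_singleton_eq_erase]
  have h := Finset.add_sum_erase Finset.univ α (Finset.mem_univ j)
  omega

/-- Degree of the chart transform: `|α'| = (|α| − n) + (|α| − α_j)`. [folklore] -/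
theorem deg_chart {d : ℕ} (n : ℕ) (j : Fin d) (α : Expo d) :
    (chart n j α).deg = (α.deg - n) + (α.deg - α j) :=
  deg_update α j _

/-- pure arithmetic. [folklore] -/
@[simp] theorem chart_apply_same {d : ℕ} (n : ℕ) (j : Fin d) (α : Expo d) : chart n j α j = α.deg - n := by
  simp [chart]

/-- pure arithmetic. [folklore] -/
theorem chart_apply_ne {d : ℕ} (n : ℕ) {j l : Fin d} (h : l ≠ j) (α : Expo d) : chart n j α l = α l := by
  simp [chart, h]

end Expo

/-- The monomial ideal `(x^α : α ∈ G)` has ORDER EXACTLY `n` at the corner. -/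
def HasOrder {d : ℕ} (n : ℕ) (G : Finset (Expo d)) : Prop :=
  (∃ α ∈ G, α.deg = n) ∧ ∀ α ∈ G, n ≤ α.deg

/-- The corner is ISOLATED in the order-`n` locus of `(x^α : α ∈ G)`: for every `l` some generator has
`|α| − α_l < n`. -/
def Isolated {d : ℕ} (n : ℕ) (G : Finset (Expo d)) : Prop :=
  ∀ l : Fin d, ∃ α ∈ G, α.deg - α l < n

/-- An infinite MONOMIAL CORNER TOWER in `d` corner parameters at marking `n`: exponent sets `G i`, chart directions
`dir i`, every stage of order exactly `n` with the corner isolated in the top locus, `G (i+1)` the controlled chart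
transform of `G i`. -/
structure CornerTower (d n : ℕ) where
  /-- exponent sets of the monomial controlled transforms -/
  G : ℕ → Finset (Expo d)
  /-- the chart in which the next point is the origin -/
  dir : ℕ → Fin d
  /-- order exactly `n` at every stage -/
  hasOrder : ∀ i, HasOrder n (G i)
  /-- the corner is isolated in the top locus at every stage -/
  isolated : ∀ i, Isolated n (G i)
  /-- the move -/
  step : ∀ i, G (i + 1) = (G i).image (Expo.chart n (dir i))

/-- LEAF (pure combinatorics; KNOWN-MOD-PORT via `CornerModel` + `TowerObstructs`; ATTACKABLE directly, cheap
theorem #17′): «no infinite monomial corner tower in `d` parameters at marking `n`». -/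
def NoCornerTower (d n : ℕ) : Prop := CornerTower d n → False

namespace CornerTower

variable {d n : ℕ} (T : CornerTower d n)

/-- An EXHAUSTIVE corner tower: every chart direction is played again after every stage (the combinatorial
shadow of «hugs no exceptional component either», critic row 58). -/
def Exhaustive : Prop := ∀ (l : Fin d) (i : ℕ), ∃ m, T.dir (i + m) = l

/-- pure combinatorics. [folklore] -/
theorem chart_mem {i : ℕ} {α : Expo d} (h : α ∈ T.G i) : Expo.chart n (T.dir i) α ∈ T.G (i + 1) := by
  rw [T.step i]
  exact Finset.mem_image_of_mem _ h

/-- LEGALITY of the move (order does not drop below `n`): `α_j ≤ 2 (|α| − n)` for every generator. [folklore] -/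
theorem dir_le_two_mul {i : ℕ} {α : Expo d} (h : α ∈ T.G i) : α (T.dir i) ≤ 2 * (α.deg - n) := by
  have h₁ := (T.hasOrder (i + 1)).2 _ (T.chart_mem h)
  have h₂ := (T.hasOrder i).2 _ h
  have h₃ := Expo.le_deg α (T.dir i)
  rw [Expo.deg_chart] at h₁
  omega

/-- The order-`n` generators VANISH in every direction played. [folklore] -/
theorem dir_eq_zero_of_deg_eq {i : ℕ} {α : Expo d} (h : α ∈ T.G i) (hα : α.deg = n) : α (T.dir i) = 0 := by
  have := T.dir_le_two_mul h
  omega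

/-- … hence they are FIXED by the move. [folklore] -/
theorem chart_eq_self_of_deg_eq {i : ℕ} {α : Expo d} (h : α ∈ T.G i) (hα : α.deg = n) :
    Expo.chart n (T.dir i) α = α := by
  have h0 := T.dir_eq_zero_of_deg_eq h hα
  unfold Expo.chart
  rw [hα, Nat.sub_self, ← h0, Function.update_eq_self]

/-- pure combinatorics. [folklore] -/
theorem deg_eq_mem_succ {i : ℕ} {α : Expo d} (h : α ∈ T.G i) (hα : α.deg = n) : α ∈ T.G (i + 1) := by
  have := T.chart_mem h
  rwa [T.chart_eq_self_of_deg_eq h hα] at this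

/-- An order-`n` generator persists at every later stage … [folklore] -/
theorem deg_eq_mem_add {i : ℕ} {α : Expo d} (h : α ∈ T.G i) (hα : α.deg = n) (m : ℕ) : α ∈ T.G (i + m) := by
  induction m with
  | zero => simpa using h
  | succ m ih => exact T.deg_eq_mem_succ ih hα

/-- … and KILLS ITS SUPPORT DIRECTIONS FOREVER. [folklore] -/
theorem dir_add_eq_zero_of_deg_eq {i : ℕ} {α : Expo d} (h : α ∈ T.G i) (hα : α.deg = n) (m : ℕ) :
    α (T.dir (i + m)) = 0 :=
  T.dir_eq_zero_of_deg_eq (T.deg_eq_mem_add h hα m) hα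

/-- The ISOLATION WITNESS in the direction played DROPS STRICTLY in degree. [folklore] -/
theorem exists_deg_lt (i : ℕ) : ∃ α ∈ T.G i, (Expo.chart n (T.dir i) α).deg < α.deg := by
  obtain ⟨α, hα, hlt⟩ := T.isolated i (T.dir i)
  refine ⟨α, hα, ?_⟩
  have h₂ := (T.hasOrder i).2 _ hα
  have h₃ := Expo.le_deg α (T.dir i)
  rw [Expo.deg_chart]
  omega

/-- **THE EXHAUSTIVE-SLOT KERNEL** (critic row 58, cheap theorem #17, PROVED): at positive marking no corner tower
is exhaustive — an order-`n` generator of stage `0` persists and vanishes in every direction ever played, so if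
every direction is played it is the zero vector, of degree `0 < n`. [folklore] -/
theorem not_exhaustive (hn : 1 ≤ n) : ¬ T.Exhaustive := by
  intro hX
  obtain ⟨α, hα, hdeg⟩ := (T.hasOrder 0).1
  have hz : ∀ l, α l = 0 := fun l => by
    obtain ⟨m, hm⟩ := hX l 0
    have h := T.dir_add_eq_zero_of_deg_eq hα hdeg m
    rwa [hm] at h
  have h0 : α.deg = 0 := Finset.sum_eq_zero fun l _ => hz l
  omega

end CornerTower

/-- `d = 0`: no corner tower (the empty sum cannot have degree `n ≥ 1`). [folklore] -/
theorem noCornerTower_zero {n : ℕ} (hn : 1 ≤ n) : NoCornerTower 0 n := by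
  intro T
  obtain ⟨α, -, hα⟩ := (T.hasOrder 0).1
  simp [Expo.deg] at hα
  omega

/-- `d = 1`: no corner tower (one blow-up of `(x^n)` drops the order to `0`). [folklore] -/
theorem noCornerTower_one {n : ℕ} (hn : 1 ≤ n) : NoCornerTower 1 n := by
  intro T
  obtain ⟨α, hα, hdeg⟩ := (T.hasOrder 0).1
  have h0 : α (T.dir 0) = 0 := T.dir_eq_zero_of_deg_eq hα hdeg
  have h1 : α.deg = α (T.dir 0) := by
    have : T.dir 0 = 0 := Fin.eq_zero _
    rw [this, Expo.deg, Fin.sum_univ_one]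
  omega

/-- Sanity (decidable data): `(x², x y³)` at marking `2` has order exactly `2` with the corner isolated in its top
locus. -/
example : HasOrder 2 ({![2, 0], ![1, 3]} : Finset (Expo 2)) ∧ Isolated 2 ({![2, 0], ![1, 3]} : Finset (Expo 2)) :=
  by unfold HasOrder Isolated; decide

/-! ## §2 Contact hugging (g8's `strictIter` / `HugsGerm` / `GermHugging` are REUSED from `DivergentTowerClasses`) -/

/-- CONTACT HUGGING («permanent contact»): a REGULAR HYPERSURFACE germ (`ord_{pt m} H = 1`) is hugged forever. -/
def ContactHugging (T : ForcedTower) : Prop :=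
  ∃ (m : ℕ) (H : (T.St m).IdealSheafData), idealOrder H (T.pt m) = 1 ∧ HugsGerm T m H

/-- pure logic. [folklore] -/
theorem germHugging_of_contactHugging {T : ForcedTower} (h : ContactHugging T) : GermHugging T := by
  obtain ⟨m, H, -, hH⟩ := h
  exact ⟨m, H, hH⟩

/-! ## §3 Tower classes (over `DivergentTowerClasses.NoTower`, boundary-free roots) -/

/-- PIECE · DECIDED-MOD-PORT (all `k`, by (M1⁺) alone): no infinite TRANSVERSAL (= hugging no germ, valuative)
forced tower.  Contains g8's located residual `ValuativeTowersTerminate`. -/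
def TransversalTowersTerminate (n : ℕ) : Prop := NoTower n fun T => ¬ GermHugging T

/-- PIECE · THE LOCATED RESIDUAL of the tower side after g9 (UNDECIDED; ≡ 30253 modulo the decided piece): no
infinite GERM-HUGGING forced tower. -/
def HuggingTowersTerminate (n : ℕ) : Prop := NoTower n GermHugging

/-- LEAF of the residual · UNDECIDED · ATTACKABLE (dim-3 shadow on the hugged regular hypersurface; critic row 52
caveat: the shadow top locus need not be isolated): no infinite tower with PERMANENT CONTACT. -/
def ContactHuggingTowersTerminate (n : ℕ) : Prop := NoTower n ContactHugging

/-- LEAF of the residual · IDEA-NEEDED (the located p-core of the tower side after g9): no infinite WILD-HUGGING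
tower — some germ is hugged forever but NO regular hypersurface germ is (Moh / kangaroo habitat). -/
def WildHuggingTowersTerminate (n : ℕ) : Prop := NoTower n fun T => GermHugging T ∧ ¬ ContactHugging T

/-- Kernel (PROVED): **EXACT `ForcedTowersTerminate n ⟺ Transversal ∧ Hugging`.** [folklore] -/
theorem forcedTowersTerminate_iff_transversal_hugging {n : ℕ} :
    ForcedTowersTerminate n ↔ TransversalTowersTerminate n ∧ HuggingTowersTerminate n := by
  rw [forcedTowersTerminate_iff_noTower, noTower_split (fun _ => True) GermHugging, and_comm]
  exact and_congr ⟨noTower_mono fun _ h => ⟨trivial, h⟩, noTower_mono fun _ h => h.2⟩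
    ⟨noTower_mono fun _ h => ⟨trivial, h⟩, noTower_mono fun _ h => h.2⟩

/-- Kernel (PROVED): **EXACT `Hugging ⟺ ContactHugging ∧ WildHugging`.** [folklore] -/
theorem huggingTowersTerminate_iff_contact_wild {n : ℕ} :
    HuggingTowersTerminate n ↔ ContactHuggingTowersTerminate n ∧ WildHuggingTowersTerminate n := by
  unfold HuggingTowersTerminate ContactHuggingTowersTerminate WildHuggingTowersTerminate
  rw [noTower_split GermHugging ContactHugging]
  exact and_congr
    ⟨noTower_mono fun _ h => ⟨germHugging_of_contactHugging h, h⟩, noTower_mono fun _ h => h.2⟩ Iff.rfl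

/-- Necessity: every piece is implied by the tower piece (WEAKER-or-equal by construction). [folklore] -/
theorem pieces_of_ftt {n : ℕ} (h : ForcedTowersTerminate n) :
    TransversalTowersTerminate n ∧ HuggingTowersTerminate n ∧ ContactHuggingTowersTerminate n ∧
      WildHuggingTowersTerminate n := by
  have h' := forcedTowersTerminate_iff_noTower.mp h
  exact ⟨noTower_mono (fun _ _ => trivial) h', noTower_mono (fun _ _ => trivial) h',
    noTower_mono (fun _ _ => trivial) h', noTower_mono (fun _ _ => trivial) h'⟩

/-- pure logic. [folklore] -/
theorem huggingTowersTerminate_of_ftt {n : ℕ} (h : ForcedTowersTerminate n) : HuggingTowersTerminate n :=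
  (pieces_of_ftt h).2.1

/-- LINK to g8: the transversal piece CONTAINS g8's valuative leaf. [folklore] -/
theorem valuativeTowersTerminate_of_transversal {n : ℕ} (h : TransversalTowersTerminate n) :
    ValuativeTowersTerminate n :=
  noTower_mono (fun _ h' => h'.2.2) h

/-- LINK to g8: the hugging piece implies g8's germ-hugging leaf … [folklore] -/
theorem germHuggingTowersTerminate_of_hugging {n : ℕ} (h : HuggingTowersTerminate n) :
    GermHuggingTowersTerminate n :=
  noTower_mono (fun _ h' => h'.2.2) h

/-- … and conversely the hugging piece follows from g8's eventually-free, τ≥2-hugging and germ-hugging leaves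
(excluded middle; the first two are DECIDED-MOD-PORT over perfect fields in `DivergentTowerClasses`). [folklore] -/
theorem huggingTowersTerminate_of_ttLeaves {n : ℕ} (hF : EventuallyFreeTowersTerminate n)
    (h2 : TauTwoHuggingTowersTerminate n) (hG : GermHuggingTowersTerminate n) : HuggingTowersTerminate n := by
  intro p hp k _ _ T g hB hD hE hH
  by_cases hs : SatelliteRecurrent T
  · by_cases ht : TauTwoHugging T n
    · exact h2 p hp k T g hB hD hE ht
    · exact hG p hp k T g hB hD hE ⟨hs, ht, hH⟩
  · exact hF p hp k T g hB hD hE (eventuallyFree_of_not_satelliteRecurrent hs)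

/-! ## §4 Ports (HYPOTHESES of kernels, counted 0) -/

/-- PORT `CornerNormalForm` — NEW LEMMA (M1) (paper proof in the module docstring): an infinite forced tower of
the class hugging NO germ is residually EVENTUALLY STATIONARY and carries an infinite MONOMIAL CORNER TOWER in
`d ≤ 4` parameters. -/
def CornerNormalForm (n : ℕ) : Prop :=
  ∀ p : ℕ, p.Prime → ∀ (k : Type) [Field k] [CharP k p] (T : ForcedTower) (g : T.St 0 ⟶ Spec (.of k)),
    IsBase (T.St 0) g → IsDatum n (T.D 0) → (T.D 0).boundary = [] → ¬ GermHugging T →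
      T.EventuallyStationary ∧ ∃ d : ℕ, d ≤ 4 ∧ Nonempty (CornerTower d n)

/-- PORT `CornerNormalFormPlus` — (M1⁺), the critic's strengthening (row 58; prover target #18): the corner tower
is moreover EXHAUSTIVE (a tower hugging no germ exits every exceptional component `V(x_l)` too, i.e. every chart
direction is played again after every stage). -/
def CornerNormalFormPlus (n : ℕ) : Prop :=
  ∀ p : ℕ, p.Prime → ∀ (k : Type) [Field k] [CharP k p] (T : ForcedTower) (g : T.St 0 ⟶ Spec (.of k)),
    IsBase (T.St 0) g → IsDatum n (T.D 0) → (T.D 0).boundary = [] → ¬ GermHugging T →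
      T.EventuallyStationary ∧ ∃ (d : ℕ) (c : CornerTower d n), d ≤ 4 ∧ c.Exhaustive

/-- (M1⁺) refines (M1). [folklore] -/
theorem cornerNormalForm_of_plus {n : ℕ} (h : CornerNormalFormPlus n) : CornerNormalForm n := by
  intro p hp k _ _ T g hB hD hE hG
  obtain ⟨hs, d, c, hd, -⟩ := h p hp k T g hB hD hE hG
  exact ⟨hs, d, hd, ⟨c⟩⟩

/-- PORT `CornerModel` (COSTUME chart bookkeeping + KNOWN toric order reduction): an infinite corner tower in
`d ≤ 4` parameters is REALISED by an infinite forced tower of the class whose initial (MONOMIAL) datum nevertheless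
HAS a weak resolution (monomial order reduction is characteristic-free). -/
def CornerModel (n : ℕ) : Prop :=
  ∀ d : ℕ, d ≤ 4 → CornerTower d n →
    ∃ (p : ℕ) (_ : p.Prime) (k : Type) (_ : Field k) (_ : CharP k p) (T : ForcedTower)
      (g : T.St 0 ⟶ Spec (.of k)),
      IsBase (T.St 0) g ∧ IsDatum n (T.D 0) ∧ ∃ t : CentreSeq (T.St 0), WeakResolution t (T.D 0)

/-! ## §5 Kernels (PROVED, 0 sorry) -/

/-- The combinatorial leaf from the two bookkeeping ports. [folklore] -/
theorem noCornerTower_of_model {n : ℕ} (hM : CornerModel n) (hT : TowerObstructs n) :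
    ∀ d : ℕ, d ≤ 4 → NoCornerTower d n := by
  intro d hd c
  obtain ⟨p, hp, k, _, _, T, g, hB, hD, t, ht⟩ := hM d hd c
  exact hT p hp k T g hB hD ⟨t, ht⟩

/-- **The transversal piece is DECIDED modulo (M1) and the combinatorial leaf.** [folklore] -/
theorem transversalTowersTerminate_of_ports {n : ℕ} (hN : CornerNormalForm n)
    (hC : ∀ d : ℕ, d ≤ 4 → NoCornerTower d n) : TransversalTowersTerminate n := by
  intro p hp k _ _ T g hB hD hE hG
  obtain ⟨-, d, hd, ⟨c⟩⟩ := hN p hp k T g hB hD hE hG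
  exact hC d hd c

/-- **The transversal piece is DECIDED modulo (M1⁺) ALONE** (exhaustive-slot kernel, `1 ≤ n`). [folklore] -/
theorem transversalTowersTerminate_of_cornerNormalFormPlus {n : ℕ} (hn : 1 ≤ n) (hN : CornerNormalFormPlus n) :
    TransversalTowersTerminate n := by
  intro p hp k _ _ T g hB hD hE hG
  obtain ⟨-, d, c, -, hX⟩ := hN p hp k T g hB hD hE hG
  exact c.not_exhaustive hn hX

/-- The tower piece from the residual modulo (M1) and the combinatorial leaf. [folklore] -/
theorem forcedTowersTerminate_of_hugging {n : ℕ} (hN : CornerNormalForm n)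
    (hC : ∀ d : ℕ, d ≤ 4 → NoCornerTower d n) (hH : HuggingTowersTerminate n) : ForcedTowersTerminate n :=
  forcedTowersTerminate_iff_transversal_hugging.mpr ⟨transversalTowersTerminate_of_ports hN hC, hH⟩

/-- The tower piece from the residual modulo (M1⁺) alone. [folklore] -/
theorem forcedTowersTerminate_of_hugging' {n : ℕ} (hn : 1 ≤ n) (hN : CornerNormalFormPlus n)
    (hH : HuggingTowersTerminate n) : ForcedTowersTerminate n :=
  forcedTowersTerminate_iff_transversal_hugging.mpr ⟨transversalTowersTerminate_of_cornerNormalFormPlus hn hN, hH⟩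

/-- **EXACT modulo the decided piece: `ForcedTowersTerminate n ⟺ HuggingTowersTerminate n`.** [folklore] -/
theorem forcedTowersTerminate_iff_hugging {n : ℕ} (hn : 1 ≤ n) (hN : CornerNormalFormPlus n) :
    ForcedTowersTerminate n ↔ HuggingTowersTerminate n :=
  ⟨huggingTowersTerminate_of_ftt, forcedTowersTerminate_of_hugging' hn hN⟩

/-- … and by the two hugging leaves. [folklore] -/
theorem forcedTowersTerminate_of_leaves {n : ℕ} (hn : 1 ≤ n) (hN : CornerNormalFormPlus n)
    (h₁ : ContactHuggingTowersTerminate n) (h₂ : WildHuggingTowersTerminate n) : ForcedTowersTerminate n :=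
  forcedTowersTerminate_of_hugging' hn hN (huggingTowersTerminate_iff_contact_wild.mpr ⟨h₁, h₂⟩)

/-- COROLLARY of (M1): a residually GROWING infinite tower HUGS a germ — g7's p-core leaf
`GrowingTowersTerminate` is implied by «no growing hugging tower». [folklore] -/
theorem growingTowersTerminate_of_hugging {n : ℕ} (hN : CornerNormalForm n)
    (h : NoTower n fun T => GermHugging T ∧ ¬ T.EventuallyStationary) : GrowingTowersTerminate n := by
  intro p hp k _ _ T g hB hD hE hns
  by_cases hG : GermHugging T
  · exact h p hp k T g hB hD hE ⟨hG, hns⟩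
  · exact hns (hN p hp k T g hB hD hE hG).1

/-- COROLLARY of (M1): g7's STATIONARY leaf already contains every transversal tower. [folklore] -/
theorem transversalTowersTerminate_of_stationary {n : ℕ} (hN : CornerNormalForm n)
    (h : StationaryTowersTerminate n) : TransversalTowersTerminate n := by
  intro p hp k _ _ T g hB hD hE hG
  exact h p hp k T g hB hD hE (hN p hp k T g hB hD hE hG).1

end Summit.ResolutionOfSingularities.ResolutionOfSingularities.Theorems.MonomialTowerClasses
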